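import Summits.RiemannHypothesis.RiemannHypothesis.Theorems.JensenLogBandArcRegime
import Mathlib.Analysis.SpecialFunctions.Pow.Asymptotics
import Mathlib.Analysis.Complex.ExponentialBounds
import HarnessLib

/-!
# The pinned regime of the TOP SHELL of the log band (RH-FREE real arithmetic)

Cell rh-jensen, LADDER-RH rung J-P(P3) «log band» (route JensenLogBand); bears_on: J-P(P3) crux
`XiDerivBandRealAllRates` (stmt-RiemannHypothesis-19913), line «top-shell» of the BAND lead
(rh-jensen-prover g8: stubs `stub_shellNear` / `stub_shellFar`, stated for rates `7 ≤ c < 8` on the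
shell `e^{c(k−1)}/4 ≤ ‖(a+iT)²‖ < e^{ck}` only). Seat rh-jensen-idea-2 g8 (negation-construct lens,
round 8). ROUTE-INDEPENDENT module (no `Theses` import). RH-FREE. WHAT THIS IS NOT: nothing here
bears on the zeros of `ζ` or the truth of RH — this is bookkeeping of logarithms.

On the top shell of rate `c > 0` the height and the arc radius are PINNED: for `k ≥ k₀(c)`,
`0 < a ≤ ½`, `0 < T`, `e^{c(k−1)}/4 ≤ a² + T² < e^{ck}`:
* the band floor `64(k/log k)² ≤ a² + T²` (so `LogBandArc.band_regime` and
  `LogBandArc.bandRadius_admissible` apply on the shell: `T ≥ 100`, `ℓ_T ≥ ℓ₀`, `½ ≤ h ≤ 7T/20`,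
  `0 < h < 2T`);
* the log-height pin `c(k−1)/2 − 4 ≤ ℓ_T ≤ ck/2`;
* the radius pin `4/c < h(k,T) ≤ 4/c + 1/log k` (`h = bandRadius k T = 2(k+1)/ℓ_T`).
So each rate `c` is ONE regime (`h = 4/c + o(1)`, `ℓ_T = ck/2 + O(1)`): for the lead's `c ∈ [7,8)`,
`h ∈ (½, 4/7 + o(1)]` (regime R2 of the S5 window, sharp descent F6) and the own/competitor windows sit
at abscissae `½ ± a + h·(1 + o(1))`.

* `eventually_topShell_ineq` — the three eventual inequalities in `k` used;
* `topShell_regime` — the pins from the shell bounds (`a² + T²` form);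
* `topShell_regime_norm` — the same with `‖(a+iT)²‖`, packaged `∃ k₀, ∀ k ≥ k₀, …` for direct use
  inside the stub proofs, together with the conclusions of `band_regime ℓ₀ c`.
-/

set_option linter.dupNamespace false

noncomputable section

open Complex Real Filter
open scoped Topology

namespace Summit.RiemannHypothesis.RiemannHypothesis.Theorems.JensenPolynomials.LogBandArc

/-- Eventual arithmetic along the top shell of rate `c > 0`:
`1 ≤ log n`, `256 n² ≤ e^{c(n−1)}`, `(4 + 16/c)·log n + 4 ≤ c(n−1)/2`. [folklore] -/
theorem eventually_topShell_ineq {c : ℝ} (hc : 0 < c) :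
    ∀ᶠ n : ℕ in atTop, 1 ≤ Real.log n ∧ 256 * (n : ℝ) ^ 2 ≤ Real.exp (c * ((n : ℝ) - 1)) ∧
      (4 + 16 / c) * Real.log n + 4 ≤ c * ((n : ℝ) - 1) / 2 := by
  have hlog : Tendsto (fun n : ℕ => Real.log (n : ℝ)) atTop atTop :=
    Real.tendsto_log_atTop.comp tendsto_natCast_atTop_atTop
  have E1 : ∀ᶠ n : ℕ in atTop, (1 : ℝ) ≤ Real.log n := hlog.eventually_ge_atTop _
  -- `256 n² ≤ e^{-c} e^{cn}`
  have E2 : ∀ᶠ n : ℕ in atTop, 256 * (n : ℝ) ^ 2 ≤ Real.exp (c * ((n : ℝ) - 1)) := by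
    have hε : (0 : ℝ) < Real.exp (-c) / 256 := by positivity
    have h := ((isLittleO_pow_exp_pos_mul_atTop 2 hc).comp_tendsto
      tendsto_natCast_atTop_atTop).bound hε
    filter_upwards [h] with n hn
    have hn0 : (0 : ℝ) ≤ (n : ℝ) ^ 2 := by positivity
    simp only [Function.comp, Real.norm_eq_abs, abs_of_nonneg hn0,
      abs_of_nonneg (Real.exp_pos _).le] at hn
    have : Real.exp (c * ((n : ℝ) - 1)) = Real.exp (-c) * Real.exp (c * (n : ℝ)) := by
      rw [← Real.exp_add]; congr 1; ring
    rw [this]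
    linarith
  -- `(4 + 16/c) log n ≤ (c/4) n` and `n ≥ (16 + 2c)/c`
  set A : ℝ := 4 + 16 / c with hA
  have hA0 : 0 < A := by positivity
  have E3 : ∀ᶠ n : ℕ in atTop, A * Real.log n ≤ c / 4 * (n : ℝ) := by
    have hε : (0 : ℝ) < c / 4 / A := by positivity
    have h := (Real.isLittleO_log_id_atTop.comp_tendsto tendsto_natCast_atTop_atTop).bound hε
    filter_upwards [h, E1] with n hn h1
    have hn0 : (0 : ℝ) ≤ (n : ℝ) := Nat.cast_nonneg n
    simp only [Function.comp, id, Real.norm_eq_abs, abs_of_nonneg hn0] at hn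
    have hlog0 : 0 ≤ Real.log (n : ℝ) := by linarith
    rw [abs_of_nonneg hlog0] at hn
    have := mul_le_mul_of_nonneg_left hn hA0.le
    calc A * Real.log n ≤ A * (c / 4 / A * (n : ℝ)) := this
      _ = c / 4 * (n : ℝ) := by field_simp
  have E4 : ∀ᶠ n : ℕ in atTop, (16 + 2 * c) / c ≤ (n : ℝ) :=
    tendsto_natCast_atTop_atTop.eventually_ge_atTop _
  filter_upwards [E1, E2, E3, E4] with n h1 h2 h3 h4
  refine ⟨h1, h2, ?_⟩
  have h5 : 16 + 2 * c ≤ c * (n : ℝ) := by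
    have := (div_le_iff₀ hc).1 h4
    linarith [mul_comm (n : ℝ) c]
  show A * Real.log n + 4 ≤ c * ((n : ℝ) - 1) / 2
  nlinarith

/-- `1 ≤ log(2π) ≤ 2` (tree `log_two_pi_bounds` gives `0 ≤ · ≤ 2`; the lower bound from `e < 3 < π`).
[folklore] -/
theorem one_le_log_two_pi : 1 ≤ Real.log (2 * Real.pi) := by
  rw [Real.le_log_iff_exp_le (by positivity)]
  have h1 := Real.exp_one_lt_d9
  have h2 := Real.pi_gt_three
  norm_num at h1
  linarith

/-- **The pinned regime of the top shell (RH-FREE arithmetic).** On the top shell of rate `c`,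
`0 < a ≤ ½`, `0 < T`, `e^{c(n−1)}/4 ≤ a² + T² < e^{cn}`, with the eventual facts of
`eventually_topShell_ineq`: the band floor `64(n/log n)² ≤ a²+T²`, the log-height pin
`c(n−1)/2 − 4 ≤ ℓ_T ≤ cn/2` and the radius pin `4/c < h(n,T) ≤ 4/c + 1/log n`. [folklore] -/
theorem topShell_regime {c : ℝ} (hc : 0 < c) {n : ℕ} (h1 : 1 ≤ Real.log n)
    (h2 : 256 * (n : ℝ) ^ 2 ≤ Real.exp (c * ((n : ℝ) - 1)))
    (h3 : (4 + 16 / c) * Real.log n + 4 ≤ c * ((n : ℝ) - 1) / 2)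
    {a T : ℝ} (ha : 0 < a) (ha2 : a ≤ 1 / 2) (hT : 0 < T)
    (hlo : Real.exp (c * ((n : ℝ) - 1)) / 4 ≤ a ^ 2 + T ^ 2) (hhi : a ^ 2 + T ^ 2 < Real.exp (c * (n : ℝ))) :
    64 * ((n : ℝ) / Real.log n) ^ 2 ≤ a ^ 2 + T ^ 2 ∧
      c * ((n : ℝ) - 1) / 2 - 4 ≤ ell T ∧ ell T ≤ c * (n : ℝ) / 2 ∧
      4 / c < bandRadius n T ∧ bandRadius n T ≤ 4 / c + 1 / Real.log n := by
  have hn0 : (0 : ℝ) ≤ (n : ℝ) := Nat.cast_nonneg n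
  have hlogpos : 0 < Real.log (n : ℝ) := by linarith
  obtain ⟨h2pi0, h2pi2⟩ := log_two_pi_bounds
  have h2pi1 := one_le_log_two_pi
  -- (1) the floor
  have hfloor : 64 * ((n : ℝ) / Real.log n) ^ 2 ≤ a ^ 2 + T ^ 2 := by
    have hq : (n : ℝ) / Real.log n ≤ n := div_le_self hn0 h1
    have hq0 : 0 ≤ (n : ℝ) / Real.log n := div_nonneg hn0 hlogpos.le
    have hq2 : ((n : ℝ) / Real.log n) ^ 2 ≤ (n : ℝ) ^ 2 := pow_le_pow_left₀ hq0 hq 2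
    linarith
  -- (2) the log-height: `log T = log(T²)/2`, `ℓ_T = log T − log 2π`
  have hell : ell T = Real.log T - Real.log (2 * Real.pi) := by
    rw [ell, Real.log_div hT.ne' (by positivity)]
  have hlogT2 : Real.log (T ^ 2) = 2 * Real.log T := by
    rw [Real.log_pow]; norm_num
  have ha' : a ^ 2 ≤ 1 / 4 := by nlinarith
  -- upper: `T² < e^{cn}` ⇒ `log T < cn/2`
  have hup : ell T ≤ c * (n : ℝ) / 2 := by
    have hT2 : T ^ 2 < Real.exp (c * (n : ℝ)) := by nlinarith
    have := Real.log_lt_log (by positivity) hT2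
    rw [Real.log_exp, hlogT2] at this
    rw [hell]; linarith
  -- lower: `T² ≥ e^{c(n−1)}/4 − 1/4 ≥ e^{c(n−1)}/8` ⇒ `log T ≥ c(n−1)/2 − (log 8)/2`
  have hE2 : 2 ≤ Real.exp (c * ((n : ℝ) - 1)) := by
    have : (1 : ℝ) ≤ (n : ℝ) ^ 2 := by
      have h1' : (1 : ℝ) ≤ n := by
        by_contra hlt
        push Not at hlt
        have : Real.log (n : ℝ) ≤ 0 := by
          rcases lt_or_ge (n : ℝ) 0 with hneg | hnn
          · linarith
          · have := Real.log_le_sub_one_of_pos (show (0:ℝ) < n by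
              by_contra h0; push Not at h0
              have : (n : ℝ) = 0 := le_antisymm h0 hnn
              rw [this, Real.log_zero] at h1; linarith)
            linarith
        linarith
      nlinarith
    linarith
  have hlow : c * ((n : ℝ) - 1) / 2 - 4 ≤ ell T := by
    have hT2 : Real.exp (c * ((n : ℝ) - 1)) / 8 ≤ T ^ 2 := by linarith
    have := Real.log_le_log (by positivity) hT2
    rw [Real.log_div (Real.exp_pos _).ne' (by norm_num), Real.log_exp, hlogT2] at this
    have hlog8 : Real.log 8 ≤ 3 := by
      have : Real.log 8 = 3 * Real.log 2 := by
        rw [show (8 : ℝ) = 2 ^ 3 by norm_num, Real.log_pow]; norm_num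
      have h := Real.log_two_lt_d9
      norm_num at h
      linarith
    rw [hell]; linarith
  have hell0 : 0 < ell T := by
    have hA0 : 0 < 4 + 16 / c := by positivity
    have : 4 + 16 / c ≤ (4 + 16 / c) * Real.log n := le_mul_of_one_le_right hA0.le h1
    linarith
  -- (3) the radius `h = 2(n+1)/ℓ_T`
  have hrad : bandRadius n T = 2 * ((n : ℝ) + 1) / ell T := rfl
  have hlowR : 4 / c < bandRadius n T := by
    rw [hrad, lt_div_iff₀ hell0]
    calc 4 / c * ell T ≤ 4 / c * (c * (n : ℝ) / 2) :=
          mul_le_mul_of_nonneg_left hup (by positivity)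
      _ = 2 * (n : ℝ) := by field_simp; ring
      _ < 2 * ((n : ℝ) + 1) := by linarith
  have hupR : bandRadius n T ≤ 4 / c + 1 / Real.log n := by
    set L₀ : ℝ := c * ((n : ℝ) - 1) / 2 - 4 with hL₀
    have hAq : 4 + 16 / c ≤ L₀ / Real.log n := by
      rw [le_div_iff₀ hlogpos]; linarith
    have hL₀pos : 0 < L₀ := by
      have : (4 + 16 / c) * Real.log n ≥ (4 + 16 / c) * 1 :=
        mul_le_mul_of_nonneg_left h1 (by positivity)
      have : 0 < 4 + 16 / c := by positivity
      linarith
    have step1 : bandRadius n T ≤ 2 * ((n : ℝ) + 1) / L₀ := by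
      rw [hrad]
      exact div_le_div_of_nonneg_left (by positivity) hL₀pos hlow
    have step2 : 2 * ((n : ℝ) + 1) / L₀ ≤ 4 / c + 1 / Real.log n := by
      rw [div_le_iff₀ hL₀pos]
      have e1 : (4 / c + 1 / Real.log n) * L₀ = 4 / c * L₀ + L₀ / Real.log n := by ring
      have e2 : 4 / c * L₀ = 2 * ((n : ℝ) - 1) - 16 / c := by
        rw [hL₀]; field_simp; ring
      rw [e1, e2]
      linarith
    exact step1.trans step2
  exact ⟨hfloor, hlow, hup, hlowR, hupR⟩

/-- **The pinned regime of the top shell, norm form, with the band regime (RH-FREE).** For every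
`ℓ₀` and every rate `0 < c ≤ 8` there is `k₀` such that for `k ≥ k₀`, `0 < a ≤ ½`, `0 < T` and
`e^{c(k−1)}/4 ≤ ‖(a+iT)²‖ < e^{ck}`: the band floor `64(k/log k)² ≤ ‖(a+iT)²‖`, `100 ≤ T`,
`ℓ₀ ≤ ℓ_T`, `c(k−1)/2 − 4 ≤ ℓ_T ≤ ck/2`, `½ ≤ h ≤ 7T/20`, `4/c < h ≤ 4/c + 1/log k`
(`h = bandRadius k T`). Directly usable inside `stub_shellNear` / `stub_shellFar` (`7 ≤ c < 8`).
[folklore] -/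
theorem topShell_regime_norm (ℓ₀ c : ℝ) (hc : 0 < c) (hc8 : c ≤ 8) :
    ∃ k₀ : ℕ, ∀ k : ℕ, k₀ ≤ k → ∀ a T : ℝ, 0 < a → a ≤ 1 / 2 → 0 < T →
      Real.exp (c * ((k : ℝ) - 1)) / 4 ≤ ‖((a : ℂ) + (T : ℂ) * I) ^ 2‖ →
      ‖((a : ℂ) + (T : ℂ) * I) ^ 2‖ < Real.exp (c * (k : ℝ)) →
      64 * ((k : ℝ) / Real.log k) ^ 2 ≤ ‖((a : ℂ) + (T : ℂ) * I) ^ 2‖ ∧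
        100 ≤ T ∧ ℓ₀ ≤ ell T ∧
        c * ((k : ℝ) - 1) / 2 - 4 ≤ ell T ∧ ell T ≤ c * (k : ℝ) / 2 ∧
        1 / 2 ≤ bandRadius k T ∧ bandRadius k T ≤ 7 / 20 * T ∧
        4 / c < bandRadius k T ∧ bandRadius k T ≤ 4 / c + 1 / Real.log k := by
  obtain ⟨k₁, hk₁⟩ := Filter.eventually_atTop.1 (eventually_topShell_ineq hc)
  obtain ⟨k₂, hk₂⟩ := band_regime ℓ₀ c hc8
  refine ⟨max k₁ k₂, fun k hk a T ha ha2 hT hlo hhi => ?_⟩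
  obtain ⟨e1, e2, e3⟩ := hk₁ k (le_trans (le_max_left _ _) hk)
  have hlo' : Real.exp (c * ((k : ℝ) - 1)) / 4 ≤ a ^ 2 + T ^ 2 := by
    rw [← norm_sq_ofReal_add_mul_I]; exact hlo
  have hhi' : a ^ 2 + T ^ 2 < Real.exp (c * (k : ℝ)) := by
    rw [← norm_sq_ofReal_add_mul_I]; exact hhi
  obtain ⟨hfloor, hellLo, hellHi, hradLo, hradHi⟩ := topShell_regime hc e1 e2 e3 ha ha2 hT hlo' hhi'
  have hfloor' : 64 * ((k : ℝ) / Real.log k) ^ 2 ≤ ‖((a : ℂ) + (T : ℂ) * I) ^ 2‖ := by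
    rw [norm_sq_ofReal_add_mul_I]; exact hfloor
  obtain ⟨hT100, hell0, hh1, hh2⟩ :=
    hk₂ k (le_trans (le_max_right _ _) hk) a T ha ha2 hT hfloor' hhi
  exact ⟨hfloor', hT100, hell0, hellLo, hellHi, hh1, hh2, hradLo, hradHi⟩

end Summit.RiemannHypothesis.RiemannHypothesis.Theorems.JensenPolynomials.LogBandArc

end
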